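import Literature.NumberTheory.Automorphic.ArchEndoscopicStableSumTorus        -- ★ (3H): `integral_comp_conj_out_conjClassesMk`, `compactSpace_archOne`, `conj_eq_self_archOne`, §5 Cayley adapter `archCongrOfEq_quasiSplitFrameTwo_symm_archDiagTorus`
import Literature.NumberTheory.Automorphic.ArchTorusOrbitalContinuity            -- ★ (V2)-glob: `isCompact_setOf_exists_conj_archDiagTorus_mem` (global joint properness on `U(diag α)_∞`), `isOpen_setOf_forall_injective`
import HarnessLib

/-!
# The `H_∞`-side orbital integrals of a `C_c` test function are CONTINUOUS on the regular elliptic torus of `H_∞ = U(Φ₂)(L ⊗ ℝ) × U(Φ₁)(L ⊗ ℝ)`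
# — Haar currency, single class and stable sum (Rogawski 1990 §4.3, §14.3 p. 234; Shelstad 1979 §4; Bouaziz 1994 §6.2)

Topic `NumberTheory/Automorphic`; namespace `Literature.NumberTheory.Automorphic.UnitaryGroup`.  THEOREMS ONLY (no `def`, no instance, no notation, no axiom,
no named fact, no `sorry`).  Cell `pub/hodgecm-mathlib`, line LH3 (closer stub `stub_N9` of `Cruxes/H413/Lines/F0_U3LettersRung1.lean`, crux H413 =
`stmt-HodgeConjecture-24833`); organ **(CONT-H-ell)** of the LH3 direct road (LH3-plan (g2) DEALER WORDS #1, census «H-TORUS» of LH3-p01 (g3), 2026-09-02): the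
`H`-side twin of LH3-p04 (g2)'s (W1-torus) `ArchEndoscopicDeltaSideContinuous`, SAME CURRENCY (conjugation integrals against a measure on the GROUP, compact
centralisers).  It is the first clause of «`Φ^st(·, f_H) ∈ I^st_c(H_∞)`» (Bouaziz's space) for the organ O3′ `stub_N9bouazizSchema` of the leaf
`Cruxes/H413/Lines/F0_P3c_StubN9Paydown.lean`, restricted to the ELLIPTIC Cartan (every place compact); count-neutral by itself.  Author LH3-p01 (g3).

THE FRAME is that of ★ (3H) `exists_finsum_integral_comp_conj_eq_mul_sum_integral_pi` VERBATIM: a diagonal hermitian `α : Fin 2 → L`, a congruence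
`ψ : U(Φ₂)_∞ ≃ₜ* U(diag α)_∞`, torus points `γ_H(u, δ) = (ψ⁻¹ t(u), δ)` with `t = archDiagTorus L 2 α`, `u : W → Fin 2 → S¹`, `δ ∈ U(Φ₁)_∞`; regular = `u_w 0 ≠ u_w 1`
at every complex place `w`.

WHAT IS PROVED.
* §1 **`isCompact_setOf_exists_conj_endoTorus_mem`** — JOINT PROPERNESS ON `H_∞`: for compact `K ⊆ T_reg` and compact `C ⊆ H_∞` the set of `h ∈ H_∞` conjugating SOME
  `γ_H(u, δ)`, `u ∈ K`, into `C` is compact (the `ψ`-pull-back of ★ `isCompact_setOf_exists_conj_archDiagTorus_mem` at `N = 2`, times the compact abelian factor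
  ★ `compactSpace_archOne` on which conjugation is trivial ★ `conj_eq_self_archOne`).  `ψ` enters only as a `≃ₜ*` (no conjugation formula needed).
* §2 **`continuousOn_integral_comp_conj_endoTorus`** — for `aH` continuous with compact support and ANY measure `νH` finite on compacts, the single-class
  Haar-currency orbital integral `(u, δ) ↦ ∫_{H_∞} aH(h·γ_H(u, δ)·h⁻¹) dνH` is continuous on `{(u, δ) | u regular}` (JOINTLY in `(u, δ)`; Mathlib
  `continuousOn_integral_of_compact_support` over §1); fixed-`δ` slice `continuousOn_integral_comp_conj_endoTorus_left`.
* §3 **`continuousOn_finsum_integral_comp_conj_stable_endoTorus`** (HEAD) — the STABLE sum `(u, δ) ↦ Σᶠ_{c : γ_H(u,δ) ∼st out c} ∫_{H_∞} aH(h·out c·h⁻¹) dνH` (the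
  `H`-side of ★ (E1) `finsum_integral_comp_conj_eq_finsum_delta_mul_integral_comp_conj_of_isArchDeltaTransfer`) is continuous on the regular set, for `νH` finite on
  compacts and right invariant: on the regular set it is the FIXED finite sum over the `2^{#W}` flips (★ `setOf_isArchStablyConjH_out_eq_range`,
  ★ `injective_conjClassesMk_flip`, representative independence ★ `integral_comp_conj_out_conjClassesMk`) of §2 at the flipped `u`.
* §4 corollaries: `ArchSmooth₂` test functions (★ `ArchSmooth₂.continuous ∕ .hasCompactSupport`); the CAYLEY FRAME of B-p12 ∕ LH3-p04's (W1-torus) family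
  (`ψ := Φ_{Q₂}` of ★ (R3-a), `α := (½, −½)`, ★ adapter `archCongrOfEq_quasiSplitFrameTwo_symm_archDiagTorus`): the torus point is
  `(e⁻¹ (w ↦ C·diag(u_w)·C⁻¹), δ)`, `C = (1 1; 1 −1)`, with NO frame hypothesis left.

CURRENCY NOTE (census «H-TORUS» (MISSING-2)).  In the Weil form `mH c = dνH ∕ dtH(out c)` of the leaf's compatible systems the centraliser datum `tH` is free per
element, so `γ ↦ Φ^st(γ, f; mH)` is NOT continuous in general; the continuous object is the Haar-currency sum of this file (all elliptic centralisers are compact),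
from which the Weil-form value is recovered class by class by ★ `IsQuotientOf.integral_comp_conj_eq_measureReal_mul_classOrbitalIntegral`.
HONEST LABEL: HC_CM is proved only modulo the 7 printed citations (2 remaining: hLiu418 = stmt-HodgeConjecture-24832, h413 = stmt-HodgeConjecture-24833) until
rung 0 closes; this file is harmonic-analysis bookkeeping under O3′ and pays nothing by itself.

## References
* [Rogawski1990] J. D. Rogawski, *Automorphic Representations of Unitary Groups in Three Variables*, Ann. of Math. Stud. 123 (1990), §3.1 p. 19 (properness of
  conjugation on the regular set), §4.3 (4.3.1) p. 43, §4.9 p. 54 (`H = U(2) × U(1)`), §8.3 p. 122, §14.3 p. 234 (`H_∞`).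
* [Shelstad1979] D. Shelstad, *Characters and inner forms of a quasi-split group over ℝ*, Compositio Math. 39 (1979), §4 (orbital integrals as functions on a Cartan
  subgroup, smooth on the regular set).
* [Bouaziz1994IntegralesOrbitales] A. Bouaziz, *Intégrales orbitales sur les groupes de Lie réductifs*, Ann. Sci. ÉNS 27 (1994) 573–609, §6.2 p. 591 (the space `I(U)`:
  smooth invariant functions on the regular set, compactly supported modulo conjugation).
* [DeitmarEchterhoff2014] A. Deitmar, S. Echterhoff, *Principles of Harmonic Analysis*, 2nd ed. (2014), Lemma 9.3.3 (continuity of parametric integrals with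
  uniformly compact support).
-/

set_option autoImplicit false

noncomputable section

open MeasureTheory Measure Filter Topology NumberField NumberField.InfinitePlace NumberField.mixedEmbedding Set Function
open Literature.MeasureTheory.Group Literature.NumberTheory.Rogawski1990
open scoped Matrix MatrixGroups

namespace Literature.NumberTheory.Automorphic

namespace UnitaryGroup

section Frame

variable (L : Type) [Field L] [NumberField L] [IsCMField L] (α : Fin 2 → L)

/-! ## §1 Joint properness of conjugation over the regular elliptic torus of `H_∞` -/

/-- **JOINT PROPERNESS ON `H_∞ = U(Φ₂)_∞ × U(Φ₁)_∞` OVER THE REGULAR ELLIPTIC TORUS.**  For `α_i ≠ 0`, a congruence `ψ : U(Φ₂)_∞ ≃ₜ* U(diag α)_∞`, a compact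
`K ⊆ T_reg = {u | ∀ w, u_w injective}` and a compact `C ⊆ H_∞`, the set of `h ∈ H_∞` with `h·(ψ⁻¹ t(u), δ)·h⁻¹ ∈ C` for SOME `u ∈ K` and SOME `δ ∈ U(Φ₁)_∞` is COMPACT:
its `U(Φ₂)`-components lie in `ψ⁻¹{g | ∃ u ∈ K, g·t(u)·g⁻¹ ∈ ψ(pr₁ C)}` (★ `isCompact_setOf_exists_conj_archDiagTorus_mem`), its `U(Φ₁)`-components in the compact
`U(Φ₁)_∞` (★ `compactSpace_archOne`), and it is the first projection of a closed subset of that compact product with `K × U(Φ₁)_∞` («`Φ(γ, f)` converges and is smooth on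
`T_reg`», Harish-Chandra; the content of «compactly supported modulo conjugation» in Bouaziz's `I(U)`). [cite: Rogawski1990, §3.1 p. 19; §8.3 p. 122; §14.3 p. 234]
[cite: DeitmarEchterhoff2014, Lemma 9.3.3] -/
theorem isCompact_setOf_exists_conj_endoTorus_mem (hα : ∀ i, α i ≠ 0)
    (ψ : arch (↥(maximalRealSubfield L)) L (IsCMField.complexConj L) 2 (Matrix.of fun i j : Fin 2 => if i.val + j.val + 1 = 2 then (1 : L) else 0) ≃ₜ*
      arch (↥(maximalRealSubfield L)) L (IsCMField.complexConj L) 2 (Matrix.diagonal α))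
    {K : Set ({w : InfinitePlace L // IsComplex w} → Fin 2 → Circle)} (hK : IsCompact K) (hKreg : K ⊆ {u | ∀ w, Function.Injective (u w)})
    {C : Set (arch (↥(maximalRealSubfield L)) L (IsCMField.complexConj L) 2 (Matrix.of fun i j : Fin 2 => if i.val + j.val + 1 = 2 then (1 : L) else 0) ×
      arch (↥(maximalRealSubfield L)) L (IsCMField.complexConj L) 1 (Matrix.of fun i j : Fin 1 => if i.val + j.val + 1 = 1 then (1 : L) else 0))}
    (hC : IsCompact C) :
    IsCompact {h : arch (↥(maximalRealSubfield L)) L (IsCMField.complexConj L) 2 (Matrix.of fun i j : Fin 2 => if i.val + j.val + 1 = 2 then (1 : L) else 0) ×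
        arch (↥(maximalRealSubfield L)) L (IsCMField.complexConj L) 1 (Matrix.of fun i j : Fin 1 => if i.val + j.val + 1 = 1 then (1 : L) else 0) |
      ∃ u ∈ K, ∃ δ : arch (↥(maximalRealSubfield L)) L (IsCMField.complexConj L) 1 (Matrix.of fun i j : Fin 1 => if i.val + j.val + 1 = 1 then (1 : L) else 0),
        h * (ψ.symm (archDiagTorus L 2 α u), δ) * h⁻¹ ∈ C} := by
  haveI := compactSpace_archOne L
  -- the compact set of `U(Φ₂)`-components: `ψ⁻¹ S`, `S` the ★ properness set for the compact `ψ(pr₁ C)`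
  have hC₂ : IsCompact (ψ '' (Prod.fst '' C)) := (hC.image continuous_fst).image ψ.continuous
  have hS := isCompact_setOf_exists_conj_archDiagTorus_mem L 2 α hα hK hKreg hC₂
  have hB : IsCompact ((ψ.symm '' {g : arch (↥(maximalRealSubfield L)) L (IsCMField.complexConj L) 2 (Matrix.diagonal α) |
      ∃ z ∈ K, g * archDiagTorus L 2 α z * g⁻¹ ∈ ψ '' (Prod.fst '' C)}) ×ˢ
      (Set.univ : Set (arch (↥(maximalRealSubfield L)) L (IsCMField.complexConj L) 1 (Matrix.of fun i j : Fin 1 => if i.val + j.val + 1 = 1 then (1 : L) else 0)))) :=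
    (hS.image ψ.symm.continuous).prod isCompact_univ
  -- the pair set `M = {(h, (u, δ)) | u ∈ K, h·γ_H(u,δ)·h⁻¹ ∈ C}` is closed and contained in the compact `B × (K × univ)`
  have hconj : Continuous fun p : (arch (↥(maximalRealSubfield L)) L (IsCMField.complexConj L) 2 (Matrix.of fun i j : Fin 2 => if i.val + j.val + 1 = 2 then (1 : L) else 0) ×
        arch (↥(maximalRealSubfield L)) L (IsCMField.complexConj L) 1 (Matrix.of fun i j : Fin 1 => if i.val + j.val + 1 = 1 then (1 : L) else 0)) ×
      (({w : InfinitePlace L // IsComplex w} → Fin 2 → Circle) ×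
        arch (↥(maximalRealSubfield L)) L (IsCMField.complexConj L) 1 (Matrix.of fun i j : Fin 1 => if i.val + j.val + 1 = 1 then (1 : L) else 0)) =>
      p.1 * (ψ.symm (archDiagTorus L 2 α p.2.1), p.2.2) * p.1⁻¹ :=
    (continuous_fst.mul ((ψ.symm.continuous.comp ((continuous_archDiagTorus L 2 α).comp (continuous_fst.comp continuous_snd))).prodMk
      (continuous_snd.comp continuous_snd))).mul continuous_fst.inv
  have hMclosed : IsClosed {p : (arch (↥(maximalRealSubfield L)) L (IsCMField.complexConj L) 2 (Matrix.of fun i j : Fin 2 => if i.val + j.val + 1 = 2 then (1 : L) else 0) ×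
        arch (↥(maximalRealSubfield L)) L (IsCMField.complexConj L) 1 (Matrix.of fun i j : Fin 1 => if i.val + j.val + 1 = 1 then (1 : L) else 0)) ×
      (({w : InfinitePlace L // IsComplex w} → Fin 2 → Circle) ×
        arch (↥(maximalRealSubfield L)) L (IsCMField.complexConj L) 1 (Matrix.of fun i j : Fin 1 => if i.val + j.val + 1 = 1 then (1 : L) else 0)) |
      p.2.1 ∈ K ∧ p.1 * (ψ.symm (archDiagTorus L 2 α p.2.1), p.2.2) * p.1⁻¹ ∈ C} :=
    (hK.isClosed.preimage (continuous_fst.comp continuous_snd)).inter (hC.isClosed.preimage hconj)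
  have hMsub : {p : (arch (↥(maximalRealSubfield L)) L (IsCMField.complexConj L) 2 (Matrix.of fun i j : Fin 2 => if i.val + j.val + 1 = 2 then (1 : L) else 0) ×
        arch (↥(maximalRealSubfield L)) L (IsCMField.complexConj L) 1 (Matrix.of fun i j : Fin 1 => if i.val + j.val + 1 = 1 then (1 : L) else 0)) ×
      (({w : InfinitePlace L // IsComplex w} → Fin 2 → Circle) ×
        arch (↥(maximalRealSubfield L)) L (IsCMField.complexConj L) 1 (Matrix.of fun i j : Fin 1 => if i.val + j.val + 1 = 1 then (1 : L) else 0)) |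
      p.2.1 ∈ K ∧ p.1 * (ψ.symm (archDiagTorus L 2 α p.2.1), p.2.2) * p.1⁻¹ ∈ C} ⊆
      ((ψ.symm '' {g : arch (↥(maximalRealSubfield L)) L (IsCMField.complexConj L) 2 (Matrix.diagonal α) |
        ∃ z ∈ K, g * archDiagTorus L 2 α z * g⁻¹ ∈ ψ '' (Prod.fst '' C)}) ×ˢ
        (Set.univ : Set (arch (↥(maximalRealSubfield L)) L (IsCMField.complexConj L) 1 (Matrix.of fun i j : Fin 1 => if i.val + j.val + 1 = 1 then (1 : L) else 0)))) ×ˢ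
      (K ×ˢ (Set.univ : Set (arch (↥(maximalRealSubfield L)) L (IsCMField.complexConj L) 1 (Matrix.of fun i j : Fin 1 => if i.val + j.val + 1 = 1 then (1 : L) else 0)))) := by
    rintro ⟨⟨h₂, h₁⟩, ⟨u, δ⟩⟩ ⟨hu, hmem⟩
    refine ⟨⟨?_, Set.mem_univ _⟩, ⟨hu, Set.mem_univ _⟩⟩
    refine ⟨ψ h₂, ⟨u, hu, ?_⟩, ψ.symm_apply_apply h₂⟩
    refine ⟨h₂ * ψ.symm (archDiagTorus L 2 α u) * h₂⁻¹, ⟨_, hmem, rfl⟩, ?_⟩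
    rw [map_mul, map_mul, map_inv, ContinuousMulEquiv.apply_symm_apply]
  have hM : IsCompact {p : (arch (↥(maximalRealSubfield L)) L (IsCMField.complexConj L) 2 (Matrix.of fun i j : Fin 2 => if i.val + j.val + 1 = 2 then (1 : L) else 0) ×
        arch (↥(maximalRealSubfield L)) L (IsCMField.complexConj L) 1 (Matrix.of fun i j : Fin 1 => if i.val + j.val + 1 = 1 then (1 : L) else 0)) ×
      (({w : InfinitePlace L // IsComplex w} → Fin 2 → Circle) ×
        arch (↥(maximalRealSubfield L)) L (IsCMField.complexConj L) 1 (Matrix.of fun i j : Fin 1 => if i.val + j.val + 1 = 1 then (1 : L) else 0)) |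
      p.2.1 ∈ K ∧ p.1 * (ψ.symm (archDiagTorus L 2 α p.2.1), p.2.2) * p.1⁻¹ ∈ C} :=
    (hB.prod (hK.prod isCompact_univ)).of_isClosed_subset hMclosed hMsub
  -- the target set is its first projection
  have heq : {h : arch (↥(maximalRealSubfield L)) L (IsCMField.complexConj L) 2 (Matrix.of fun i j : Fin 2 => if i.val + j.val + 1 = 2 then (1 : L) else 0) ×
        arch (↥(maximalRealSubfield L)) L (IsCMField.complexConj L) 1 (Matrix.of fun i j : Fin 1 => if i.val + j.val + 1 = 1 then (1 : L) else 0) |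
      ∃ u ∈ K, ∃ δ : arch (↥(maximalRealSubfield L)) L (IsCMField.complexConj L) 1 (Matrix.of fun i j : Fin 1 => if i.val + j.val + 1 = 1 then (1 : L) else 0),
        h * (ψ.symm (archDiagTorus L 2 α u), δ) * h⁻¹ ∈ C} =
      Prod.fst '' {p : (arch (↥(maximalRealSubfield L)) L (IsCMField.complexConj L) 2 (Matrix.of fun i j : Fin 2 => if i.val + j.val + 1 = 2 then (1 : L) else 0) ×
        arch (↥(maximalRealSubfield L)) L (IsCMField.complexConj L) 1 (Matrix.of fun i j : Fin 1 => if i.val + j.val + 1 = 1 then (1 : L) else 0)) ×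
      (({w : InfinitePlace L // IsComplex w} → Fin 2 → Circle) ×
        arch (↥(maximalRealSubfield L)) L (IsCMField.complexConj L) 1 (Matrix.of fun i j : Fin 1 => if i.val + j.val + 1 = 1 then (1 : L) else 0)) |
      p.2.1 ∈ K ∧ p.1 * (ψ.symm (archDiagTorus L 2 α p.2.1), p.2.2) * p.1⁻¹ ∈ C} := by
    ext h
    constructor
    · rintro ⟨u, hu, δ, hmem⟩
      exact ⟨(h, (u, δ)), ⟨hu, hmem⟩, rfl⟩
    · rintro ⟨⟨h', ⟨u, δ⟩⟩, ⟨hu, hmem⟩, rfl⟩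
      exact ⟨u, hu, δ, hmem⟩
  rw [heq]
  exact hM.image continuous_fst

/-! ## §2 The single-class Haar-currency orbital integral is continuous on the regular elliptic torus -/

/-- **THE CONJUGATION AVERAGE `(u, δ) ↦ ∫_{H_∞} aH(h·(ψ⁻¹ t(u), δ)·h⁻¹) dνH(h)` IS CONTINUOUS ON `{(u, δ) | u regular}`** — jointly in the torus coordinates, for `aH`
continuous with compact support and ANY measure `νH` on `H_∞` finite on compact sets (e.g. a Haar measure): near a regular `u₀` the integrands for `(u, δ) ∈ K × U(Φ₁)_∞`,
`K` a compact neighbourhood of `u₀` in `T_reg`, are supported in ONE compact set (§1), so Mathlib `continuousOn_integral_of_compact_support` applies.  This is the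
HAAR-CURRENCY orbital integral `Φ(γ_H, aH)·tH(Z(γ_H))` of the leaf's Weil-form families at the elliptic `γ_H = (ψ⁻¹ t(u), δ)` (compact centraliser).
[cite: Rogawski1990, §4.3 (4.3.1) p. 43; §8.3 p. 122; §14.3 p. 234] [cite: Shelstad1979, §4] [cite: DeitmarEchterhoff2014, Lemma 9.3.3] -/
theorem continuousOn_integral_comp_conj_endoTorus (hα : ∀ i, α i ≠ 0)
    [MeasurableSpace (arch (↥(maximalRealSubfield L)) L (IsCMField.complexConj L) 2 (Matrix.of fun i j : Fin 2 => if i.val + j.val + 1 = 2 then (1 : L) else 0) ×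
      arch (↥(maximalRealSubfield L)) L (IsCMField.complexConj L) 1 (Matrix.of fun i j : Fin 1 => if i.val + j.val + 1 = 1 then (1 : L) else 0))]
    [BorelSpace (arch (↥(maximalRealSubfield L)) L (IsCMField.complexConj L) 2 (Matrix.of fun i j : Fin 2 => if i.val + j.val + 1 = 2 then (1 : L) else 0) ×
      arch (↥(maximalRealSubfield L)) L (IsCMField.complexConj L) 1 (Matrix.of fun i j : Fin 1 => if i.val + j.val + 1 = 1 then (1 : L) else 0))]
    (νH : Measure (arch (↥(maximalRealSubfield L)) L (IsCMField.complexConj L) 2 (Matrix.of fun i j : Fin 2 => if i.val + j.val + 1 = 2 then (1 : L) else 0) ×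
      arch (↥(maximalRealSubfield L)) L (IsCMField.complexConj L) 1 (Matrix.of fun i j : Fin 1 => if i.val + j.val + 1 = 1 then (1 : L) else 0)))
    [IsFiniteMeasureOnCompacts νH]
    (ψ : arch (↥(maximalRealSubfield L)) L (IsCMField.complexConj L) 2 (Matrix.of fun i j : Fin 2 => if i.val + j.val + 1 = 2 then (1 : L) else 0) ≃ₜ*
      arch (↥(maximalRealSubfield L)) L (IsCMField.complexConj L) 2 (Matrix.diagonal α))
    {E : Type*} [NormedAddCommGroup E] [NormedSpace ℝ E]
    (aH : arch (↥(maximalRealSubfield L)) L (IsCMField.complexConj L) 2 (Matrix.of fun i j : Fin 2 => if i.val + j.val + 1 = 2 then (1 : L) else 0) ×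
      arch (↥(maximalRealSubfield L)) L (IsCMField.complexConj L) 1 (Matrix.of fun i j : Fin 1 => if i.val + j.val + 1 = 1 then (1 : L) else 0) → E)
    (ha : Continuous aH) (hac : HasCompactSupport aH) :
    ContinuousOn (fun p : ({w : InfinitePlace L // IsComplex w} → Fin 2 → Circle) ×
        arch (↥(maximalRealSubfield L)) L (IsCMField.complexConj L) 1 (Matrix.of fun i j : Fin 1 => if i.val + j.val + 1 = 1 then (1 : L) else 0) =>
      ∫ h, aH (h * (ψ.symm (archDiagTorus L 2 α p.1), p.2) * h⁻¹) ∂νH) {p | ∀ w, Function.Injective (p.1 w)} := by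
  intro p₀ hp₀
  -- a compact neighbourhood `K` of `u₀` inside the open regular set
  have hp₀' : p₀.1 ∈ {z : {w : InfinitePlace L // IsComplex w} → Fin 2 → Circle | ∀ w, Function.Injective (z w)} := hp₀
  obtain ⟨K, hKnhds, hKsub, hK⟩ := local_compact_nhds (Literature.Topology.isOpen_setOf_forall_injective.mem_nhds hp₀')
  have hk := isCompact_setOf_exists_conj_endoTorus_mem L α hα ψ hK hKsub hac.isCompact
  have hsnhds : K ×ˢ (Set.univ : Set (arch (↥(maximalRealSubfield L)) L (IsCMField.complexConj L) 1 (Matrix.of fun i j : Fin 1 => if i.val + j.val + 1 = 1 then (1 : L) else 0))) ∈ 𝓝 p₀ :=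
    prod_mem_nhds hKnhds Filter.univ_mem
  have hcont : ContinuousOn (fun p : ({w : InfinitePlace L // IsComplex w} → Fin 2 → Circle) ×
        arch (↥(maximalRealSubfield L)) L (IsCMField.complexConj L) 1 (Matrix.of fun i j : Fin 1 => if i.val + j.val + 1 = 1 then (1 : L) else 0) =>
      ∫ h, aH (h * (ψ.symm (archDiagTorus L 2 α p.1), p.2) * h⁻¹) ∂νH)
      (K ×ˢ (Set.univ : Set (arch (↥(maximalRealSubfield L)) L (IsCMField.complexConj L) 1 (Matrix.of fun i j : Fin 1 => if i.val + j.val + 1 = 1 then (1 : L) else 0)))) := by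
    refine continuousOn_integral_of_compact_support hk ?_ ?_
    · refine Continuous.continuousOn ?_
      exact ha.comp ((continuous_snd.mul ((ψ.symm.continuous.comp ((continuous_archDiagTorus L 2 α).comp (continuous_fst.comp continuous_fst))).prodMk
        (continuous_snd.comp continuous_fst))).mul continuous_snd.inv)
    · intro p h hp hh
      exact image_eq_zero_of_notMem_tsupport fun hmem => hh ⟨p.1, hp.1, p.2, hmem⟩
  exact ((continuousWithinAt_iff_continuousAt hsnhds).mp (hcont p₀ (mem_of_mem_nhds hsnhds))).continuousWithinAt

/-- Fixed-`δ` slice of `continuousOn_integral_comp_conj_endoTorus`: `u ↦ ∫_{H_∞} aH(h·(ψ⁻¹ t(u), δ)·h⁻¹) dνH` is continuous on `T_reg = {u | ∀ w, u_w injective}`.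
[cite: Rogawski1990, §8.3 p. 122; §14.3 p. 234] [cite: Shelstad1979, §4] -/
theorem continuousOn_integral_comp_conj_endoTorus_left (hα : ∀ i, α i ≠ 0)
    [MeasurableSpace (arch (↥(maximalRealSubfield L)) L (IsCMField.complexConj L) 2 (Matrix.of fun i j : Fin 2 => if i.val + j.val + 1 = 2 then (1 : L) else 0) ×
      arch (↥(maximalRealSubfield L)) L (IsCMField.complexConj L) 1 (Matrix.of fun i j : Fin 1 => if i.val + j.val + 1 = 1 then (1 : L) else 0))]
    [BorelSpace (arch (↥(maximalRealSubfield L)) L (IsCMField.complexConj L) 2 (Matrix.of fun i j : Fin 2 => if i.val + j.val + 1 = 2 then (1 : L) else 0) ×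
      arch (↥(maximalRealSubfield L)) L (IsCMField.complexConj L) 1 (Matrix.of fun i j : Fin 1 => if i.val + j.val + 1 = 1 then (1 : L) else 0))]
    (νH : Measure (arch (↥(maximalRealSubfield L)) L (IsCMField.complexConj L) 2 (Matrix.of fun i j : Fin 2 => if i.val + j.val + 1 = 2 then (1 : L) else 0) ×
      arch (↥(maximalRealSubfield L)) L (IsCMField.complexConj L) 1 (Matrix.of fun i j : Fin 1 => if i.val + j.val + 1 = 1 then (1 : L) else 0)))
    [IsFiniteMeasureOnCompacts νH]
    (ψ : arch (↥(maximalRealSubfield L)) L (IsCMField.complexConj L) 2 (Matrix.of fun i j : Fin 2 => if i.val + j.val + 1 = 2 then (1 : L) else 0) ≃ₜ*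
      arch (↥(maximalRealSubfield L)) L (IsCMField.complexConj L) 2 (Matrix.diagonal α))
    {E : Type*} [NormedAddCommGroup E] [NormedSpace ℝ E]
    (aH : arch (↥(maximalRealSubfield L)) L (IsCMField.complexConj L) 2 (Matrix.of fun i j : Fin 2 => if i.val + j.val + 1 = 2 then (1 : L) else 0) ×
      arch (↥(maximalRealSubfield L)) L (IsCMField.complexConj L) 1 (Matrix.of fun i j : Fin 1 => if i.val + j.val + 1 = 1 then (1 : L) else 0) → E)
    (ha : Continuous aH) (hac : HasCompactSupport aH)
    (δ : arch (↥(maximalRealSubfield L)) L (IsCMField.complexConj L) 1 (Matrix.of fun i j : Fin 1 => if i.val + j.val + 1 = 1 then (1 : L) else 0)) :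
    ContinuousOn (fun u : {w : InfinitePlace L // IsComplex w} → Fin 2 → Circle =>
      ∫ h, aH (h * (ψ.symm (archDiagTorus L 2 α u), δ) * h⁻¹) ∂νH) {u | ∀ w, Function.Injective (u w)} := by
  have hf : Continuous fun u : {w : InfinitePlace L // IsComplex w} → Fin 2 → Circle => (u, δ) := continuous_id.prodMk continuous_const
  have key := (continuousOn_integral_comp_conj_endoTorus L α hα νH ψ aH ha hac).comp
    (hf.continuousOn (s := {u : {w : InfinitePlace L // IsComplex w} → Fin 2 → Circle | ∀ w, Function.Injective (u w)})) fun _ hu => hu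
  refine key.congr fun u _ => ?_
  simp only [Function.comp_apply]

/-! ## §3 HEAD: the stable Haar-currency sum is continuous on the regular elliptic torus -/

omit [NumberField L] [IsCMField L] in
/-- The flip `u ↦ u^ε` (`u_w^{tt} = u_w ∘ swap`, ★ (3H)'s convention) is continuous. [cite: Rogawski1990, §3.7 Prop. 3.7.1 pp. 29–30] -/
theorem continuous_flip_place (ε : {w : InfinitePlace L // IsComplex w} → Bool) :
    Continuous fun u : {w : InfinitePlace L // IsComplex w} → Fin 2 → Circle =>
      (fun w => if ε w then u w ∘ ⇑(Equiv.swap (0 : Fin 2) 1) else u w) := by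
  refine continuous_pi fun w => ?_
  by_cases hw : ε w
  · simp only [hw, ↓reduceIte]
    exact continuous_pi fun i => (continuous_apply _).comp (continuous_apply w)
  · simp only [hw, Bool.false_eq_true, ↓reduceIte]
    exact continuous_apply w

omit [NumberField L] [IsCMField L] in
/-- The flip of a regular `u` is regular. [cite: Rogawski1990, §3.7 Prop. 3.7.1 pp. 29–30] -/
theorem injective_flip_place (ε : {w : InfinitePlace L // IsComplex w} → Bool) {u : {w : InfinitePlace L // IsComplex w} → Fin 2 → Circle}
    (hu : ∀ w, u w 0 ≠ u w 1) (w : {w : InfinitePlace L // IsComplex w}) :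
    Function.Injective ((fun w => if ε w then u w ∘ ⇑(Equiv.swap (0 : Fin 2) 1) else u w) w) := by
  by_cases hw : ε w
  · simp only [hw, ↓reduceIte]
    exact injective_of_apply_zero_ne_apply_one _ (comp_swap_apply_zero_ne _ (hu w))
  · simp only [hw, Bool.false_eq_true, ↓reduceIte]
    exact injective_of_apply_zero_ne_apply_one _ (hu w)

open scoped Classical in
/-- **(CONT-H-ell) THE STABLE HAAR-CURRENCY SUM IS CONTINUOUS ON THE REGULAR ELLIPTIC TORUS OF `H_∞`.**  Frame of ★ (3H) VERBATIM (`α` diagonal hermitian non-degenerate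
with `re σ_w(α₀)·re σ_w(α₁) < 0` at every complex place, `ψ : U(Φ₂)_∞ ≃ₜ* U(diag α)_∞` conjugating by `T`); `νH` any measure on `H_∞` finite on compacts and right
invariant; `aH` continuous with compact support.  Then
`(u, δ) ↦ ∑ᶠ_{c : (ψ⁻¹ t(u), δ) ∼st out c} ∫_{H_∞} aH(h·out c·h⁻¹) dνH(h)` is continuous on `{(u, δ) | ∀ w, u_w 0 ≠ u_w 1}`:
there the classes of the stable class are EXACTLY the `2^{#W}` flips (★ `setOf_isArchStablyConjH_out_eq_range`, ★ `injective_conjClassesMk_flip`), the `finsum` is the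
fixed finite sum `Σ_ε ∫ aH(h·(ψ⁻¹ t(u^ε), δ)·h⁻¹) dνH` (representative independence ★ `integral_comp_conj_out_conjClassesMk`), and each term is §2 at `u^ε`.  The set is
the `H`-regular elliptic torus; the `G`-regular one (`IsArchGRegular`) is a subset.  This is the `H`-side of ★ (E1)
`finsum_integral_comp_conj_eq_finsum_delta_mul_integral_comp_conj_of_isArchDeltaTransfer` as a FUNCTION of the torus point — the first clause («smooth, hence continuous,
stably invariant function on the regular set of the Cartan») of `Φ^st(·, aH) ∈ I^st_c(H_∞)` on the elliptic Cartan. [cite: Rogawski1990, §4.3 (4.3.1) p. 43; §14.3 p. 234;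
§3.7 Prop. 3.7.1 pp. 29–30] [cite: Shelstad1979, §4] [cite: Bouaziz1994IntegralesOrbitales, §6.2 p. 591] -/
theorem continuousOn_finsum_integral_comp_conj_stable_endoTorus
    (hα : ∀ i, α i ≠ 0) (hherm : ∀ i, (IsCMField.complexConj L (α i) : L) = α i)
    (hsgn : ∀ w : {w : InfinitePlace L // IsComplex w}, (w.1.embedding (α 0)).re * (w.1.embedding (α 1)).re < 0)
    [MeasurableSpace (arch (↥(maximalRealSubfield L)) L (IsCMField.complexConj L) 2 (Matrix.of fun i j : Fin 2 => if i.val + j.val + 1 = 2 then (1 : L) else 0) ×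
      arch (↥(maximalRealSubfield L)) L (IsCMField.complexConj L) 1 (Matrix.of fun i j : Fin 1 => if i.val + j.val + 1 = 1 then (1 : L) else 0))]
    [BorelSpace (arch (↥(maximalRealSubfield L)) L (IsCMField.complexConj L) 2 (Matrix.of fun i j : Fin 2 => if i.val + j.val + 1 = 2 then (1 : L) else 0) ×
      arch (↥(maximalRealSubfield L)) L (IsCMField.complexConj L) 1 (Matrix.of fun i j : Fin 1 => if i.val + j.val + 1 = 1 then (1 : L) else 0))]
    (νH : Measure (arch (↥(maximalRealSubfield L)) L (IsCMField.complexConj L) 2 (Matrix.of fun i j : Fin 2 => if i.val + j.val + 1 = 2 then (1 : L) else 0) ×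
      arch (↥(maximalRealSubfield L)) L (IsCMField.complexConj L) 1 (Matrix.of fun i j : Fin 1 => if i.val + j.val + 1 = 1 then (1 : L) else 0)))
    [IsFiniteMeasureOnCompacts νH] [νH.IsMulRightInvariant]
    (T : GL (Fin 2) (mixedSpace L))
    (ψ : arch (↥(maximalRealSubfield L)) L (IsCMField.complexConj L) 2 (Matrix.of fun i j : Fin 2 => if i.val + j.val + 1 = 2 then (1 : L) else 0) ≃ₜ*
      arch (↥(maximalRealSubfield L)) L (IsCMField.complexConj L) 2 (Matrix.diagonal α))
    (hψ : ∀ x, ((ψ x : arch (↥(maximalRealSubfield L)) L (IsCMField.complexConj L) 2 (Matrix.diagonal α)) : GL (Fin 2) (mixedSpace L)) =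
      T * (x : GL (Fin 2) (mixedSpace L)) * T⁻¹)
    {E : Type*} [NormedAddCommGroup E] [NormedSpace ℝ E]
    (aH : arch (↥(maximalRealSubfield L)) L (IsCMField.complexConj L) 2 (Matrix.of fun i j : Fin 2 => if i.val + j.val + 1 = 2 then (1 : L) else 0) ×
      arch (↥(maximalRealSubfield L)) L (IsCMField.complexConj L) 1 (Matrix.of fun i j : Fin 1 => if i.val + j.val + 1 = 1 then (1 : L) else 0) → E)
    (ha : Continuous aH) (hac : HasCompactSupport aH) :
    ContinuousOn (fun p : ({w : InfinitePlace L // IsComplex w} → Fin 2 → Circle) ×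
        arch (↥(maximalRealSubfield L)) L (IsCMField.complexConj L) 1 (Matrix.of fun i j : Fin 1 => if i.val + j.val + 1 = 1 then (1 : L) else 0) =>
      ∑ᶠ c ∈ {c : ConjClasses (arch (↥(maximalRealSubfield L)) L (IsCMField.complexConj L) 2 (Matrix.of fun i j : Fin 2 => if i.val + j.val + 1 = 2 then (1 : L) else 0) ×
          arch (↥(maximalRealSubfield L)) L (IsCMField.complexConj L) 1 (Matrix.of fun i j : Fin 1 => if i.val + j.val + 1 = 1 then (1 : L) else 0)) |
            IsArchStablyConjH L (ψ.symm (archDiagTorus L 2 α p.1), p.2) (Quotient.out c)},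
        ∫ h, aH (h * Quotient.out c * h⁻¹) ∂νH) {p | ∀ w, p.1 w 0 ≠ p.1 w 1} := by
  -- on the regular set the `finsum` is the finite flip sum of single-class integrals
  have heq : Set.EqOn (fun p : ({w : InfinitePlace L // IsComplex w} → Fin 2 → Circle) ×
        arch (↥(maximalRealSubfield L)) L (IsCMField.complexConj L) 1 (Matrix.of fun i j : Fin 1 => if i.val + j.val + 1 = 1 then (1 : L) else 0) =>
      ∑ ε : {w : InfinitePlace L // IsComplex w} → Bool,
        ∫ h, aH (h * (ψ.symm (archDiagTorus L 2 α fun w => if ε w then p.1 w ∘ ⇑(Equiv.swap (0 : Fin 2) 1) else p.1 w), p.2) * h⁻¹) ∂νH)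
      (fun p => ∑ᶠ c ∈ {c : ConjClasses (arch (↥(maximalRealSubfield L)) L (IsCMField.complexConj L) 2 (Matrix.of fun i j : Fin 2 => if i.val + j.val + 1 = 2 then (1 : L) else 0) ×
          arch (↥(maximalRealSubfield L)) L (IsCMField.complexConj L) 1 (Matrix.of fun i j : Fin 1 => if i.val + j.val + 1 = 1 then (1 : L) else 0)) |
            IsArchStablyConjH L (ψ.symm (archDiagTorus L 2 α p.1), p.2) (Quotient.out c)},
        ∫ h, aH (h * Quotient.out c * h⁻¹) ∂νH) {p | ∀ w, p.1 w 0 ≠ p.1 w 1} := by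
    intro p hp
    simp only
    rw [setOf_isArchStablyConjH_out_eq_range L α T ψ hψ hα hherm p.1 hp p.2, finsum_mem_range (injective_conjClassesMk_flip L α ψ hα hherm hsgn p.1 hp p.2),
      finsum_eq_sum_of_fintype]
    refine Finset.sum_congr rfl fun ε _ => ?_
    rw [integral_comp_conj_out_conjClassesMk]
  refine ContinuousOn.congr ?_ heq.symm
  refine continuousOn_finsetSum _ fun ε _ => ?_
  have hf : Continuous fun p : ({w : InfinitePlace L // IsComplex w} → Fin 2 → Circle) ×
      arch (↥(maximalRealSubfield L)) L (IsCMField.complexConj L) 1 (Matrix.of fun i j : Fin 1 => if i.val + j.val + 1 = 1 then (1 : L) else 0) =>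
      ((fun w => if ε w then p.1 w ∘ ⇑(Equiv.swap (0 : Fin 2) 1) else p.1 w), p.2) :=
    ((continuous_flip_place L ε).comp continuous_fst).prodMk continuous_snd
  have key := (continuousOn_integral_comp_conj_endoTorus L α hα νH ψ aH ha hac).comp
    (hf.continuousOn (s := {p : ({w : InfinitePlace L // IsComplex w} → Fin 2 → Circle) ×
      arch (↥(maximalRealSubfield L)) L (IsCMField.complexConj L) 1 (Matrix.of fun i j : Fin 1 => if i.val + j.val + 1 = 1 then (1 : L) else 0) | ∀ w, p.1 w 0 ≠ p.1 w 1}))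
    fun p hp w => injective_flip_place L ε hp w
  refine key.congr fun p _ => ?_
  simp only [Function.comp_apply]

/-! ## §4 Corollaries: `ArchSmooth₂` test functions; the Cayley frame of LH3-p04's (W1-torus) family -/

/-- (CONT-H-ell) for genuine archimedean test functions `aH ∈ C_c^∞(H_∞)` (★ `ArchSmooth₂`: continuous ★ `.continuous`, compactly supported ★ `.hasCompactSupport`).
[cite: Rogawski1990, §14.3 p. 234; §4.9 Prop. 4.9.1 (a) p. 55] [cite: Shelstad1979, §4] -/
theorem continuousOn_finsum_integral_comp_conj_stable_endoTorus_of_archSmooth₂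
    (hα : ∀ i, α i ≠ 0) (hherm : ∀ i, (IsCMField.complexConj L (α i) : L) = α i)
    (hsgn : ∀ w : {w : InfinitePlace L // IsComplex w}, (w.1.embedding (α 0)).re * (w.1.embedding (α 1)).re < 0)
    [MeasurableSpace (arch (↥(maximalRealSubfield L)) L (IsCMField.complexConj L) 2 (Matrix.of fun i j : Fin 2 => if i.val + j.val + 1 = 2 then (1 : L) else 0) ×
      arch (↥(maximalRealSubfield L)) L (IsCMField.complexConj L) 1 (Matrix.of fun i j : Fin 1 => if i.val + j.val + 1 = 1 then (1 : L) else 0))]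
    [BorelSpace (arch (↥(maximalRealSubfield L)) L (IsCMField.complexConj L) 2 (Matrix.of fun i j : Fin 2 => if i.val + j.val + 1 = 2 then (1 : L) else 0) ×
      arch (↥(maximalRealSubfield L)) L (IsCMField.complexConj L) 1 (Matrix.of fun i j : Fin 1 => if i.val + j.val + 1 = 1 then (1 : L) else 0))]
    (νH : Measure (arch (↥(maximalRealSubfield L)) L (IsCMField.complexConj L) 2 (Matrix.of fun i j : Fin 2 => if i.val + j.val + 1 = 2 then (1 : L) else 0) ×
      arch (↥(maximalRealSubfield L)) L (IsCMField.complexConj L) 1 (Matrix.of fun i j : Fin 1 => if i.val + j.val + 1 = 1 then (1 : L) else 0)))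
    [IsFiniteMeasureOnCompacts νH] [νH.IsMulRightInvariant]
    (T : GL (Fin 2) (mixedSpace L))
    (ψ : arch (↥(maximalRealSubfield L)) L (IsCMField.complexConj L) 2 (Matrix.of fun i j : Fin 2 => if i.val + j.val + 1 = 2 then (1 : L) else 0) ≃ₜ*
      arch (↥(maximalRealSubfield L)) L (IsCMField.complexConj L) 2 (Matrix.diagonal α))
    (hψ : ∀ x, ((ψ x : arch (↥(maximalRealSubfield L)) L (IsCMField.complexConj L) 2 (Matrix.diagonal α)) : GL (Fin 2) (mixedSpace L)) =
      T * (x : GL (Fin 2) (mixedSpace L)) * T⁻¹)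
    (aH : arch (↥(maximalRealSubfield L)) L (IsCMField.complexConj L) 2 (Matrix.of fun i j : Fin 2 => if i.val + j.val + 1 = 2 then (1 : L) else 0) ×
      arch (↥(maximalRealSubfield L)) L (IsCMField.complexConj L) 1 (Matrix.of fun i j : Fin 1 => if i.val + j.val + 1 = 1 then (1 : L) else 0) → ℂ)
    (ha : ArchSmooth₂ L aH) :
    ContinuousOn (fun p : ({w : InfinitePlace L // IsComplex w} → Fin 2 → Circle) ×
        arch (↥(maximalRealSubfield L)) L (IsCMField.complexConj L) 1 (Matrix.of fun i j : Fin 1 => if i.val + j.val + 1 = 1 then (1 : L) else 0) =>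
      ∑ᶠ c ∈ {c : ConjClasses (arch (↥(maximalRealSubfield L)) L (IsCMField.complexConj L) 2 (Matrix.of fun i j : Fin 2 => if i.val + j.val + 1 = 2 then (1 : L) else 0) ×
          arch (↥(maximalRealSubfield L)) L (IsCMField.complexConj L) 1 (Matrix.of fun i j : Fin 1 => if i.val + j.val + 1 = 1 then (1 : L) else 0)) |
            IsArchStablyConjH L (ψ.symm (archDiagTorus L 2 α p.1), p.2) (Quotient.out c)},
        ∫ h, aH (h * Quotient.out c * h⁻¹) ∂νH) {p | ∀ w, p.1 w 0 ≠ p.1 w 1} :=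
  continuousOn_finsum_integral_comp_conj_stable_endoTorus L α hα hherm hsgn νH T ψ hψ aH ha.continuous ha.hasCompactSupport

end Frame

/-! ### The Cayley frame (no frame hypothesis left): `ψ := Φ_{Q₂}`, `α := (½, −½)`, torus point `(e⁻¹ (w ↦ C·diag(u_w)·C⁻¹), δ)` -/

section Cayley

variable (L : Type) [Field L] [NumberField L] [IsCMField L]

/-- **(CONT-H-ell) IN THE CAYLEY FRAME** of B-p12 ∕ ★ (3H) §5 ∕ LH3-p04's (W1-torus) family: for `aH ∈ C_c(H_∞)`, `νH` finite on compacts and right invariant,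
`(u, δ) ↦ ∑ᶠ_{c : (e⁻¹(w ↦ C·diag(u_w)·C⁻¹), δ) ∼st out c} ∫_{H_∞} aH(h·out c·h⁻¹) dνH` is continuous on `{(u, δ) | ∀ w, u_w 0 ≠ u_w 1}` (`C = (1 1; 1 −1)`, `e = archPiEquivCM 2 L Φ₂`)
— `continuousOn_finsum_integral_comp_conj_stable_endoTorus` at the endoscopic congruence `Φ_{Q₂} : U(Φ₂)_∞ ≃ₜ* U(diag(½, −½))_∞` of ★ (R3-a) (`hψ` by `rfl`, `hα hherm hsgn` by ★
`quasiSplitWeightsTwo_ne_zero`, `cmConjRingHom_quasiSplitWeightsTwo`, `re_embedding_quasiSplitWeightsTwo_mul_neg`), rewritten through the ★ adapter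
`archCongrOfEq_quasiSplitFrameTwo_symm_archDiagTorus`.  With `u w := ![z w 0, z w 2]` and `δ := e⁻¹(w ↦ diag(z w 1))` this is LH3-p04's torus point `γH z`.
[cite: Rogawski1990, §8.2 p. 122; §4.9 p. 54; §14.3 p. 234] [cite: Shelstad1979, §4] -/
theorem continuousOn_finsum_integral_comp_conj_stable_cayleyTorus
    [MeasurableSpace (arch (↥(maximalRealSubfield L)) L (IsCMField.complexConj L) 2 (Matrix.of fun i j : Fin 2 => if i.val + j.val + 1 = 2 then (1 : L) else 0) ×
      arch (↥(maximalRealSubfield L)) L (IsCMField.complexConj L) 1 (Matrix.of fun i j : Fin 1 => if i.val + j.val + 1 = 1 then (1 : L) else 0))]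
    [BorelSpace (arch (↥(maximalRealSubfield L)) L (IsCMField.complexConj L) 2 (Matrix.of fun i j : Fin 2 => if i.val + j.val + 1 = 2 then (1 : L) else 0) ×
      arch (↥(maximalRealSubfield L)) L (IsCMField.complexConj L) 1 (Matrix.of fun i j : Fin 1 => if i.val + j.val + 1 = 1 then (1 : L) else 0))]
    (νH : Measure (arch (↥(maximalRealSubfield L)) L (IsCMField.complexConj L) 2 (Matrix.of fun i j : Fin 2 => if i.val + j.val + 1 = 2 then (1 : L) else 0) ×
      arch (↥(maximalRealSubfield L)) L (IsCMField.complexConj L) 1 (Matrix.of fun i j : Fin 1 => if i.val + j.val + 1 = 1 then (1 : L) else 0)))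
    [IsFiniteMeasureOnCompacts νH] [νH.IsMulRightInvariant]
    {E : Type*} [NormedAddCommGroup E] [NormedSpace ℝ E]
    (aH : arch (↥(maximalRealSubfield L)) L (IsCMField.complexConj L) 2 (Matrix.of fun i j : Fin 2 => if i.val + j.val + 1 = 2 then (1 : L) else 0) ×
      arch (↥(maximalRealSubfield L)) L (IsCMField.complexConj L) 1 (Matrix.of fun i j : Fin 1 => if i.val + j.val + 1 = 1 then (1 : L) else 0) → E)
    (ha : Continuous aH) (hac : HasCompactSupport aH) :
    ContinuousOn (fun p : ({w : InfinitePlace L // IsComplex w} → Fin 2 → Circle) ×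
        arch (↥(maximalRealSubfield L)) L (IsCMField.complexConj L) 1 (Matrix.of fun i j : Fin 1 => if i.val + j.val + 1 = 1 then (1 : L) else 0) =>
      ∑ᶠ c ∈ {c : ConjClasses (arch (↥(maximalRealSubfield L)) L (IsCMField.complexConj L) 2 (Matrix.of fun i j : Fin 2 => if i.val + j.val + 1 = 2 then (1 : L) else 0) ×
          arch (↥(maximalRealSubfield L)) L (IsCMField.complexConj L) 1 (Matrix.of fun i j : Fin 1 => if i.val + j.val + 1 = 1 then (1 : L) else 0)) |
            IsArchStablyConjH L
              ((archPiEquivCM 2 L (Matrix.of fun i j : Fin 2 => if i.val + j.val + 1 = 2 then (1 : L) else 0)).symm fun w =>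
                ⟨Matrix.GeneralLinearGroup.mkOfDetNeZero !![(1 : ℂ), 1; 1, -1] det_cayleyTwo_ne_zero * circleDiagonal 2 (p.1 w) *
                    (Matrix.GeneralLinearGroup.mkOfDetNeZero !![(1 : ℂ), 1; 1, -1] det_cayleyTwo_ne_zero)⁻¹,
                  cayley_conj_circleDiagonal_mem_archLocal L w _⟩, p.2)
              (Quotient.out c)},
        ∫ h, aH (h * Quotient.out c * h⁻¹) ∂νH) {p | ∀ w, p.1 w 0 ≠ p.1 w 1} := by
  have h := continuousOn_finsum_integral_comp_conj_stable_endoTorus L (![(2 : L)⁻¹, -(2 : L)⁻¹]) (quasiSplitWeightsTwo_ne_zero (L := L))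
    (fun i => cmConjRingHom_quasiSplitWeightsTwo L i) (re_embedding_quasiSplitWeightsTwo_mul_neg L) νH
    (Matrix.GeneralLinearGroup.map (mixedEmbedding L) (Matrix.GeneralLinearGroup.mkOfDetNeZero !![(1 : L), 1; 1, -1] (det_quasiSplitFrameTwo_ne_zero L)))
    (unitaryGroupOfFormCongrOfEq (conjMixed (↥(maximalRealSubfield L)) L (IsCMField.complexConj L))
      (Matrix.GeneralLinearGroup.map (mixedEmbedding L) (Matrix.GeneralLinearGroup.mkOfDetNeZero !![(1 : L), 1; 1, -1] (det_quasiSplitFrameTwo_ne_zero L)))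
      (archFormOf L 2 (Matrix.diagonal ![(2 : L)⁻¹, -(2 : L)⁻¹])) (archFormOf L 2 (Matrix.of fun i j : Fin 2 => if i.val + j.val + 1 = 2 then (1 : L) else 0))
      (formCongr_map_mixedEmbedding_archFormOf_eq L (formCongr_quasiSplitFrameTwo_diagonal L)))
    (fun _ => rfl) aH ha hac
  -- the ★ adapter moves the torus point to the Cayley frame; `congrArg` + `exact` lets the kernel unfold `arch` in the implicit carrier arguments
  refine h.congr fun p _ => ?_
  exact (congrArg (fun X : arch (↥(maximalRealSubfield L)) L (IsCMField.complexConj L) 2 (Matrix.of fun i j : Fin 2 => if i.val + j.val + 1 = 2 then (1 : L) else 0) =>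
      ∑ᶠ c ∈ {c : ConjClasses (arch (↥(maximalRealSubfield L)) L (IsCMField.complexConj L) 2 (Matrix.of fun i j : Fin 2 => if i.val + j.val + 1 = 2 then (1 : L) else 0) ×
          arch (↥(maximalRealSubfield L)) L (IsCMField.complexConj L) 1 (Matrix.of fun i j : Fin 1 => if i.val + j.val + 1 = 1 then (1 : L) else 0)) |
            IsArchStablyConjH L (X, p.2) (Quotient.out c)},
        ∫ h, aH (h * Quotient.out c * h⁻¹) ∂νH)
    (archCongrOfEq_quasiSplitFrameTwo_symm_archDiagTorus L p.1)).symm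

end Cayley

end UnitaryGroup

end Literature.NumberTheory.Automorphic

end
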